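import Mathlib
import Summits.Ventures.PercRepro2.CrossAPrimeVMarkedVdBK
import Summits.Ventures.PercRepro2.CutVertexDefs

/-!
# The v-marked vdB–Kahn inequality is an EQUALITY when the root separates the two marks
(blind cell PercRepro2, p5 g40; S4 §2.4 (s) addendum 57)

If `a₁` is a cut vertex (`CutV.IsCut ends a₁ VA VB EA EB`) with `o` and `v` on the `A`-side and
`b` on the `B`-side, the cluster of `a₁` is the union of two independent side clusters and every
mass of `VMarkedVdBK` factorises: with `ō = P_A(a₁ ↮ o)`, `ℓ = P_A(a₁ ↔ v)`, `ōℓ = P_A(a₁ ↮ o, a₁ ↔ v)`,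
`b̄ = P_B(a₁ ↮ b)`,

  `P(R_o)·P(R_b ∩ L) + P(R_b)·P(R_o ∩ L) = ō·ℓ·b̄ + b̄·ōℓ = P(L)·P(R_{o,b}) + P(R_{o,b} ∩ L)`

(`vMarkedVdBK_eq_of_cut`, hence `vMarkedVdBK_of_cut`); by the `o ↔ b` symmetry of the statement
(`vMarkedVdBK_comm`) the same holds with `v` on the `B`-side (`vMarkedVdBK_of_cut'`).  This is the
equality locus of the candidate (★₂′) identified in addendum 56 (the referee's tree dichotomy, now
for arbitrary sides): the inequality measures the interaction of the two marks through paths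
avoiding the root.  Tools: the side events and the product law of `CutVertexDefs.lean`
(`connEvent_eq_sideEvent`, `prob_sideEvent_inter_eq_mul`).  Own work; standard axioms.
-/

namespace Summit.Ventures.PercRepro2

open CutV CrossAPrimeVMarked

namespace CrossAPrimeVMarkedCut

variable {V : Type*} {E : Type*} [Fintype E] [DecidableEq E] [Fintype V] [DecidableEq V]
  {R : Type*} [Field R] [LinearOrder R] [IsStrictOrderedRing R]
variable {ends : E → Sym2 V} {a₁ : V} {VA VB : Set V} {EA EB : Set E}

omit [Fintype V] in
/-- The statement `VMarkedVdBK` is symmetric in the two marks `o`, `b`. -/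
theorem vMarkedVdBK_comm (p : E → R) (ends : E → Sym2 V) (a₁ v o b : V) :
    VMarkedVdBK p ends a₁ v o b ↔ VMarkedVdBK p ends a₁ v b o := by
  unfold VMarkedVdBK
  have e : ({b, o} : Finset V) = {o, b} := Finset.pair_comm b o
  rw [e]
  constructor <;> intro h <;> linarith

section Cut

variable [DecidablePred (· ∈ EA)] [DecidablePred (· ∈ EB)]

omit [Fintype E] [DecidableEq E] [Fintype V] [DecidableEq V] in
/-- A side event of a complement is the complement of the side event. -/
lemma sideEvent_compl (F : Set E) [DecidablePred (· ∈ F)] (A : Set (Config E)) :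
    sideEvent F Aᶜ = (sideEvent F A)ᶜ := rfl

omit [Fintype E] [DecidableEq E] [Fintype V] [DecidableEq V] in
/-- A side event of an intersection is the intersection of the side events. -/
lemma sideEvent_inter (F : Set E) [DecidablePred (· ∈ F)] (A B : Set (Config E)) :
    sideEvent F (A ∩ B) = sideEvent F A ∩ sideEvent F B := rfl

omit [Fintype E] [DecidableEq E] [Fintype V] [DecidableEq V] [DecidablePred (· ∈ EB)] in
/-- The avoidance of an `A`-side vertex is read on the `A`-side. -/
lemma avoidAll_singleton_eq_sideEvent (h : IsCut ends a₁ VA VB EA EB) {u : V} (hu : u ∈ VA) :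
    avoidAll ends a₁ {u} = sideEvent EA (connEvent ends a₁ u)ᶜ := by
  rw [avoidAll_singleton, sideEvent_compl]
  exact congrArg compl
    (connEvent_eq_sideEvent h (Set.mem_union_right _ (Set.mem_singleton a₁)) (Set.mem_union_left _ hu))

omit [Fintype E] [DecidableEq E] [Fintype V] [DecidableEq V] [DecidablePred (· ∈ EA)] in
/-- The avoidance of a `B`-side vertex is read on the `B`-side. -/
lemma avoidAll_singleton_eq_sideEvent' (h : IsCut ends a₁ VA VB EA EB) {u : V} (hu : u ∈ VB) :
    avoidAll ends a₁ {u} = sideEvent EB (connEvent ends a₁ u)ᶜ := by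
  rw [avoidAll_singleton, sideEvent_compl]
  exact congrArg compl
    (connEvent_eq_sideEvent h.symm (Set.mem_union_right _ (Set.mem_singleton a₁))
      (Set.mem_union_left _ hu))

omit [Fintype V] [LinearOrder R] [IsStrictOrderedRing R] in
/-- **The v-marked vdB–Kahn inequality is an equality across a cut vertex at the root** (`o`, `v` on
the `A`-side, `b` on the `B`-side): both sides equal `P_A(a₁ ↮ o)·P_A(a₁ ↔ v)·P_B(a₁ ↮ b) +
P_A(a₁ ↮ o, a₁ ↔ v)·P_B(a₁ ↮ b)`. -/
theorem vMarkedVdBK_eq_of_cut (p : E → R) (h : IsCut ends a₁ VA VB EA EB) {v o b : V}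
    (hv : v ∈ VA) (ho : o ∈ VA) (hb : b ∈ VB) :
    prob p (avoidAll ends a₁ {o}) * prob p (avoidAll ends a₁ {b} ∩ connEvent ends a₁ v) +
        prob p (avoidAll ends a₁ {b}) * prob p (avoidAll ends a₁ {o} ∩ connEvent ends a₁ v) =
      prob p (connEvent ends a₁ v) * prob p (avoidAll ends a₁ {o, b}) +
        prob p (avoidAll ends a₁ {o, b} ∩ connEvent ends a₁ v) := by
  have eL : connEvent ends a₁ v = sideEvent EA (connEvent ends a₁ v) :=
    connEvent_eq_sideEvent h (Set.mem_union_right _ (Set.mem_singleton a₁)) (Set.mem_union_left _ hv)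
  have eo := avoidAll_singleton_eq_sideEvent h ho
  have eb := avoidAll_singleton_eq_sideEvent' h hb
  have eob : avoidAll ends a₁ {o, b} = avoidAll ends a₁ {o} ∩ avoidAll ends a₁ {b} := avoidAll_pair ends a₁ o b
  rw [eob, eo, eb, eL]
  -- regroup every event as (A-side event) ∩ (B-side event) and factorise
  have h1 : sideEvent EB (connEvent ends a₁ b)ᶜ ∩ sideEvent EA (connEvent ends a₁ v) =
      sideEvent EA (connEvent ends a₁ v) ∩ sideEvent EB (connEvent ends a₁ b)ᶜ := Set.inter_comm _ _
  have h2 : sideEvent EA (connEvent ends a₁ o)ᶜ ∩ sideEvent EA (connEvent ends a₁ v) =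
      sideEvent EA ((connEvent ends a₁ o)ᶜ ∩ connEvent ends a₁ v) := (sideEvent_inter _ _ _).symm
  have h3 : sideEvent EA (connEvent ends a₁ o)ᶜ ∩ sideEvent EB (connEvent ends a₁ b)ᶜ ∩
        sideEvent EA (connEvent ends a₁ v) =
      sideEvent EA ((connEvent ends a₁ o)ᶜ ∩ connEvent ends a₁ v) ∩
        sideEvent EB (connEvent ends a₁ b)ᶜ := by
    rw [sideEvent_inter]
    ext ω
    simp only [Set.mem_inter_iff]
    tauto
  rw [h1, h2, h3, prob_sideEvent_inter_eq_mul p h, prob_sideEvent_inter_eq_mul p h,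
    prob_sideEvent_inter_eq_mul p h]
  ring

omit [Fintype V] [IsStrictOrderedRing R] in
/-- `VMarkedVdBK` holds (with equality) when `a₁` is a cut vertex with `o, v` on one side and `b` on
the other. -/
theorem vMarkedVdBK_of_cut (p : E → R) (h : IsCut ends a₁ VA VB EA EB) {v o b : V} (hv : v ∈ VA)
    (ho : o ∈ VA) (hb : b ∈ VB) : VMarkedVdBK p ends a₁ v o b :=
  le_of_eq (vMarkedVdBK_eq_of_cut p h hv ho hb)

omit [Fintype V] in
/-- The mirror case: `o` on one side, `b` and `v` on the other. -/
theorem vMarkedVdBK_of_cut' (p : E → R) (h : IsCut ends a₁ VA VB EA EB) {v o b : V} (hv : v ∈ VB)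
    (ho : o ∈ VA) (hb : b ∈ VB) : VMarkedVdBK p ends a₁ v o b :=
  (vMarkedVdBK_comm p ends a₁ v o b).2 (vMarkedVdBK_of_cut p h.symm hv hb ho)

end Cut

end CrossAPrimeVMarkedCut

end Summit.Ventures.PercRepro2
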